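import Summits.Ventures.CertifiedManyBodySolver.Downfold.EmeryBandReductionAcrossCu
import Literature.MathematicalPhysics.QuantumLattice.CuprateAxialOrbitalDownfold
import HarnessLib

/-!
# The axial (Cu-4s / apical) channel at the four-point level: invisible to `t_B`, it moves
# `(t′_B, t″_B)` along the fixed direction `(δ, −δ/2)` and the nesting-line `t′ − 2t″` by `2δ`

Venture CertifiedManyBodySolver, cell `pub/hubbard-downfold` (stage S1, technique B of the
three-band → one-band reduction), seat hubbard-downfold-mod-4; namespace
`Summit.Ventures.CertifiedManyBodySolver.Downfold.Emery`. Everything here is PROVED (exact algebra on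
the closed forms of `EmeryBlochBand` / `EmeryBandReductionAcrossCu`); nothing is certified physics.

Setting. In the four-orbital cuprate model (Cu d_{x²−y²}, O pₓ, O p_y, axial s) the axial orbital at
energy `ε_s` couples to the oxygen σ orbitals with amplitudes `2 t_sp sx`, `2 t_sp sy`; eliminating it
at a fixed energy `ε < ε_s` (Löwdin / energy-linearised downfolding, the construction behind the
Pavarini–Andersen range parameter `r`) adds to the `p` block the rank-one term
`−4a · (sx, sy)ᵀ(sx, sy)` with `a = t_sp² / (ε_s − ε) ≥ 0` [cite: PavariniEtAl2001, Eqs. (1)–(3)]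
(the 4×4 ↔ 3×3 determinant identity is typed in the cell's Literature file
`CuprateAxialOrbitalDownfold`, hubbard-downfold-lit-1). In the parametrisation of
`EmeryBandReductionAcrossCu.bloch4 Δ t_pd t_pp c` (`c = t_pp′`) that term is EXACTLY the co-shift
`(t_pp, c) ↦ (t_pp + a, c + a)` (`bloch4_coshift_sub`). Consequences for technique B's four-point map
(`tB4`, `tpB4`, `tppB4`):

* `abM_coshift`, `abS_coshift` — the antibonding energies at M and S are INVARIANT (the axial orbital
  couples only to the a₁g oxygen combination, which decouples from d there); only X moves.
* `tB4_coshift` — technique B's `t` is INVARIANT under the axial channel (any `a`).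
* `tpB4_coshift_sub`, `tppB4_coshift_sub`, `tppB4_coshift_eq_neg_half` — `t′_B` changes by
  `δ = (abX(Δ + 4c + 4a) − abX(Δ + 4c))/8` and `t″_B` by `−δ/2`: Pavarini's `t″ ≈ ½|t′|` increment rule,
  exact at the four points; `tpB4_coshift_le` / `le_tppB4_coshift`: for `a ≥ 0`, `δ ≤ 0` (t′ more
  cuprate-like, t″ larger).
* `tpB4_add_two_tppB4_coshift` — `t′_B + 2 t″_B` is invariant; `tpEff_coshift_sub` — the nesting-line
  combination `t′_B − 2 t″_B` (object E, `OneBandNestingFold`) moves by `2δ`: the t–t′-only object feels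
  the axial channel TWICE as strongly as object M's `t′` (the cell's numbers: HgBa₂CuO₄ σ-model t′
  deficit 0.11–0.15 in object M vs 0.22–0.27 in object E; router/INFLATION-RULES-3to1-B.md §B.10(c)).

* §5 (bridge to lit-1's Literature file `CuprateAxialOrbitalDownfold`): `threeBandAxial_eq_bloch4`,
  `det_fourBand_eq_zero_iff_bloch4`, `tB4_axial_pure` (`t_B` = pd-only value for every `a`),
  `tpB4_axial_pure_sub` / `tppB4_axial_pure_sub` / `tpB4_axial_pure_le` (the cuprate sign of `t′_B` in the
  pure four-orbital model is entirely the axial channel, cf. `tpB_pos_of_tpp_eq_zero`).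

* §6 (the apical lever composed with the co-shift, lit-1's `CuprateFourOrbital.axialLevel`): the admixture
  `a = t_sp²/(ε_s − ε)` is antitone in `ε_s` (`axialShift_anti`); `tpB4_coshift_anti` / `tppB4_coshift_mono` /
  `tpEff_coshift_anti` (monotonicity in the admixture); `tB4_apical_lever`, `tpB4_apical_lever`,
  `tppB4_apical_lever`, `tpEff_apical_lever`: a stronger Cu-s/apical coupling (compression) leaves `t_B`
  fixed, makes `t′_B` less cuprate-like, lowers `t″_B`, raises `t′_B − 2t″_B` — the sign content of the
  cell's first P > 0 technique-B row (HgBa2CuO4.md §REDUCTION-B v0.3 (c)).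

HONEST FRAMING: `a` is a free parameter here (energy-linearised elimination); the statements say what
ANY amount of axial admixture can and cannot do to the band-level one-band parameters — in particular
technique B's `t_eV` token is untouched by it, while its t′/t″ context rows are not determinations.
-/

noncomputable section

namespace Summit.Ventures.CertifiedManyBodySolver.Downfold.Emery

open Real

/-! ## §1 The co-shift is the Löwdin-eliminated axial orbital -/

/-- Co-shifting `(t_pp, t_pp′)` by `a` adds exactly the rank-one axial term `−4a·(sx,sy)ᵀ(sx,sy)` on
the oxygen block (the energy-linearised Cu-4s/apical channel with `a = t_sp²/(ε_s − ε)`).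
[cite: PavariniEtAl2001, Eqs. (1)–(3)] -/
theorem bloch4_coshift_sub (Δ tpd tpp c a sx sy : ℝ) :
    bloch4 Δ tpd (tpp + a) (c + a) sx sy - bloch4 Δ tpd tpp c sx sy =
      !![0, 0, 0;
         0, -4 * a * sx ^ 2, -4 * a * sx * sy;
         0, -4 * a * sx * sy, -4 * a * sy ^ 2] := by
  ext i j
  fin_cases i <;> fin_cases j <;> simp [bloch4] <;> ring

/-! ## §2 Invariance at M and S, hence of `t_B` -/

/-- The antibonding energy at M is invariant under the axial co-shift. [folklore] -/
theorem abM_coshift (Δ tpd tpp c a : ℝ) :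
    abM (Δ + 4 * (c + a)) tpd (tpp + a) = abM (Δ + 4 * c) tpd tpp := by
  have h : Δ + 4 * (c + a) - 4 * (tpp + a) = Δ + 4 * c - 4 * tpp := by ring
  simp only [abM, h]
  ring

/-- The antibonding energy at S = (π/2, π/2) is invariant under the axial co-shift. [folklore] -/
theorem abS_coshift (Δ tpd tpp c a : ℝ) :
    abS (Δ + 2 * (c + a)) tpd (tpp + a) = abS (Δ + 2 * c) tpd tpp := by
  have h : Δ + 2 * (c + a) - 2 * (tpp + a) = Δ + 2 * c - 2 * tpp := by ring
  simp only [abS, h]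
  ring

/-- Technique B's nearest-neighbour hopping `t_B` is INVARIANT under the axial channel (any `a`).
[folklore] -/
theorem tB4_coshift (Δ tpd tpp c a : ℝ) :
    tB4 Δ tpd (tpp + a) (c + a) = tB4 Δ tpd tpp c := by
  simp only [tB4, tB, abM_coshift]

/-! ## §3 The (δ, −δ/2) rule for `(t′_B, t″_B)` -/

/-- `t′_B` moves by `δ = (abX(Δ + 4(c + a)) − abX(Δ + 4c))/8` under the axial co-shift. [folklore] -/
theorem tpB4_coshift_sub (Δ tpd tpp c a : ℝ) :
    tpB4 Δ tpd (tpp + a) (c + a) - tpB4 Δ tpd tpp c =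
      (abX (Δ + 4 * (c + a)) tpd - abX (Δ + 4 * c) tpd) / 8 := by
  simp only [tpB4, tpB, abM_coshift]
  ring

/-- `t″_B` moves by `−δ/2` under the axial co-shift. [folklore] -/
theorem tppB4_coshift_sub (Δ tpd tpp c a : ℝ) :
    tppB4 Δ tpd (tpp + a) (c + a) - tppB4 Δ tpd tpp c =
      -((abX (Δ + 4 * (c + a)) tpd - abX (Δ + 4 * c) tpd) / 16) := by
  simp only [tppB4, abS_coshift, abM_coshift]
  ring

/-- Pavarini's increment rule, exact at the four points: `Δt″_B = −Δt′_B / 2`.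
[cite: PavariniEtAl2001, p. 3 («t″ ≈ t′/2»)] -/
theorem tppB4_coshift_eq_neg_half (Δ tpd tpp c a : ℝ) :
    tppB4 Δ tpd (tpp + a) (c + a) - tppB4 Δ tpd tpp c =
      -(tpB4 Δ tpd (tpp + a) (c + a) - tpB4 Δ tpd tpp c) / 2 := by
  rw [tpB4_coshift_sub, tppB4_coshift_sub]
  ring

/-- `t′_B + 2 t″_B` is invariant under the axial channel. [folklore] -/
theorem tpB4_add_two_tppB4_coshift (Δ tpd tpp c a : ℝ) :
    tpB4 Δ tpd (tpp + a) (c + a) + 2 * tppB4 Δ tpd (tpp + a) (c + a) =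
      tpB4 Δ tpd tpp c + 2 * tppB4 Δ tpd tpp c := by
  have h1 := tpB4_coshift_sub Δ tpd tpp c a
  have h2 := tppB4_coshift_sub Δ tpd tpp c a
  linarith

/-- The nesting-line combination `t′_B − 2 t″_B` (object E's `t′_eff`, `OneBandNestingFold`) moves by
`2δ`: twice the shift of object M's `t′_B`. [folklore] -/
theorem tpEff_coshift_sub (Δ tpd tpp c a : ℝ) :
    (tpB4 Δ tpd (tpp + a) (c + a) - 2 * tppB4 Δ tpd (tpp + a) (c + a)) -
        (tpB4 Δ tpd tpp c - 2 * tppB4 Δ tpd tpp c) =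
      2 * (tpB4 Δ tpd (tpp + a) (c + a) - tpB4 Δ tpd tpp c) := by
  have h1 := tpB4_coshift_sub Δ tpd tpp c a
  have h2 := tppB4_coshift_sub Δ tpd tpp c a
  linarith

/-! ## §4 Signs: an axial admixture (`a ≥ 0`) makes `t′_B` more cuprate-like and raises `t″_B` -/

/-- For `a ≥ 0` the axial channel lowers `t′_B` (`δ ≤ 0`). [folklore] -/
theorem tpB4_coshift_le {Δ tpd tpp c a : ℝ} (ha : 0 ≤ a) :
    tpB4 Δ tpd (tpp + a) (c + a) ≤ tpB4 Δ tpd tpp c := by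
  have hX : abX (Δ + 4 * (c + a)) tpd ≤ abX (Δ + 4 * c) tpd :=
    abX_anti_Delta (by linarith)
  have h1 := tpB4_coshift_sub Δ tpd tpp c a
  have : (abX (Δ + 4 * (c + a)) tpd - abX (Δ + 4 * c) tpd) / 8 ≤ 0 := by
    apply div_nonpos_of_nonpos_of_nonneg <;> linarith
  linarith

/-- For `a ≥ 0` the axial channel raises `t″_B`. [folklore] -/
theorem le_tppB4_coshift {Δ tpd tpp c a : ℝ} (ha : 0 ≤ a) :
    tppB4 Δ tpd tpp c ≤ tppB4 Δ tpd (tpp + a) (c + a) := by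
  have h := tppB4_coshift_eq_neg_half Δ tpd tpp c a
  have h' := tpB4_coshift_le (Δ := Δ) (tpd := tpd) (tpp := tpp) (c := c) ha
  linarith

/-- For `a ≥ 0` the nesting-line `t′_B − 2t″_B` decreases (object E more cuprate-like), by twice
`|δ|`. [folklore] -/
theorem tpEff_coshift_le {Δ tpd tpp c a : ℝ} (ha : 0 ≤ a) :
    tpB4 Δ tpd (tpp + a) (c + a) - 2 * tppB4 Δ tpd (tpp + a) (c + a) ≤
      tpB4 Δ tpd tpp c - 2 * tppB4 Δ tpd tpp c := by
  have h := tpEff_coshift_sub Δ tpd tpp c a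
  have h' := tpB4_coshift_le (Δ := Δ) (tpd := tpd) (tpp := tpp) (c := c) ha
  linarith

/-! ## §5 Bridge to the Literature four-orbital model (`CuprateAxialOrbitalDownfold`, lit-1 p476152):
in the PURE four-orbital model (no direct O–O hopping) the s-eliminated matrix is `bloch4` at the
co-shifted point `(t_pp, t_pp′) = (a, a)`, so `t_B` is the pd-only value for every `a` and the cuprate
sign of `t′_B` comes ENTIRELY from the axial channel -/

/-- lit-1's Löwdin-eliminated three-band matrix (`ε_d = 0`, `ε_p = −Δ`, axial coupling `c`) is
entry-for-entry `bloch4 Δ t_pd c c`. [cite: PavariniEtAl2001, Eqs. (1)–(3)] -/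
theorem threeBandAxial_eq_bloch4 (Δ tpd c sx sy : ℝ) :
    Literature.MathematicalPhysics.QuantumLattice.CuprateFourOrbital.threeBandAxial 0 (-Δ) tpd c sx sy =
      bloch4 Δ tpd c c sx sy := by
  ext i j
  fin_cases i <;> fin_cases j <;>
    simp [Literature.MathematicalPhysics.QuantumLattice.CuprateFourOrbital.threeBandAxial, bloch4]

/-- The four-orbital secular equation at an energy `ε ≠ ε_s` is the `bloch4` secular equation at the
co-shifted point `a = t_sp²/(ε_s − ε)` (energy-dependent O–O hopping via Cu s).
[cite: PavariniEtAl2001, Eqs. (1)–(3)] -/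
theorem det_fourBand_eq_zero_iff_bloch4 (Δ εs tpd tsp sx sy ε : ℝ) (hε : ε ≠ εs) :
    (ε • (1 : Matrix (Fin 4) (Fin 4) ℝ) -
        Literature.MathematicalPhysics.QuantumLattice.CuprateFourOrbital.fourBand 0 εs (-Δ) tpd tsp sx sy).det
        = 0 ↔
      (ε • (1 : Matrix (Fin 3) (Fin 3) ℝ) - bloch4 Δ tpd (tsp ^ 2 / (εs - ε)) (tsp ^ 2 / (εs - ε)) sx sy).det
        = 0 := by
  rw [Literature.MathematicalPhysics.QuantumLattice.CuprateFourOrbital.det_fourBand_eq_zero_iff_threeBand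
    0 εs (-Δ) tpd tsp sx sy ε hε, threeBandAxial_eq_bloch4]

/-- In the pure four-orbital model technique B's `t` is the pd-ONLY value `t_B(Δ, t_pd, 0)` for every
axial coupling `a` (the range parameter does not touch `t` at the four points). [folklore] -/
theorem tB4_axial_pure (Δ tpd a : ℝ) : tB4 Δ tpd a a = tB Δ tpd 0 := by
  have h := tB4_coshift Δ tpd 0 0 a
  simp only [zero_add] at h
  rw [h]
  exact (tB4_zero Δ tpd 0).1

/-- In the pure four-orbital model `t′_B(a) = t′_B(pd-only) + (abX(Δ + 4a) − abX Δ)/8`. [folklore] -/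
theorem tpB4_axial_pure_sub (Δ tpd a : ℝ) :
    tpB4 Δ tpd a a - tpB Δ tpd 0 = (abX (Δ + 4 * a) tpd - abX Δ tpd) / 8 := by
  have h := tpB4_coshift_sub Δ tpd 0 0 a
  simp only [zero_add, mul_zero, add_zero] at h
  rw [← (tB4_zero Δ tpd 0).2.1]
  exact h

/-- In the pure four-orbital model `t″_B(a) = t″_B(pd-only) − (abX(Δ + 4a) − abX Δ)/16`. [folklore] -/
theorem tppB4_axial_pure_sub (Δ tpd a : ℝ) :
    tppB4 Δ tpd a a - tppB Δ tpd 0 = -((abX (Δ + 4 * a) tpd - abX Δ tpd) / 16) := by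
  have h := tppB4_coshift_sub Δ tpd 0 0 a
  simp only [zero_add, mul_zero, add_zero] at h
  rw [← (tB4_zero Δ tpd 0).2.2]
  exact h

/-- In the pure four-orbital model an axial admixture `a ≥ 0` can only LOWER `t′_B` from its pd-only
value, which is positive (`tpB_pos_of_tpp_eq_zero`: the anti-cuprate sign): at the four-point level the
cuprate sign of `t′` in the Pavarini–Andersen model is entirely the axial channel. [folklore] -/
theorem tpB4_axial_pure_le {Δ tpd a : ℝ} (ha : 0 ≤ a) : tpB4 Δ tpd a a ≤ tpB Δ tpd 0 := by
  have h := tpB4_coshift_le (Δ := Δ) (tpd := tpd) (tpp := 0) (c := 0) ha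
  simp only [zero_add] at h
  rw [← (tB4_zero Δ tpd 0).2.1]
  exact h


/-! ## §6 The apical lever composed with the co-shift (lit-1's `CuprateFourOrbital.axialLevel`, §9 of
`CuprateAxialOrbitalDownfold`): a STRONGER Cu-s/apical coupling `t_sc` (shorter Cu–O_apical distance,
e.g. under compression) RAISES the axial level `ε_s = ε_s̄ + 2t_sc²/(ε_F − ε_c)`, hence SHRINKS the
energy-linearised admixture `a = t_sp²/(ε_s − ε)` at a fixed band energy `ε < ε_s`; by §2–§4 this
leaves `t_B` untouched, makes `t′_B` LESS cuprate-like and lowers `t″_B` by half as much. This is the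
band-level content of the cell's first P > 0 technique-B row (router/BOXES/HgBa2CuO4.md §REDUCTION-B
v0.3 (c): under 10 GPa the direct one-band |t′/t| of HgBa₂CuO₄ falls by 0.063 while the σ three-band
rows stay flat and `t` is tracked; the non-σ increments come as (δ, −δ/2)). Sign statements only —
nothing here determines `a`, `r` or a pressure coefficient. -/

/-- The energy-linearised axial admixture `a(ε_s) = t_sp² / (ε_s − ε)` entering the co-shift
(`bloch4_coshift_sub`) is non-negative for a band energy at or below the axial level.
[cite: PavariniEtAl2001, Eqs. (1)–(3)] -/
theorem axialShift_nonneg {tsp ε εs : ℝ} (h : ε ≤ εs) : 0 ≤ tsp ^ 2 / (εs - ε) :=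
  div_nonneg (sq_nonneg _) (by linarith)

/-- The admixture is ANTITONE in the axial level above the band energy: raising `ε_s` shrinks `a`.
[folklore] -/
theorem axialShift_anti {tsp ε εs₁ εs₂ : ℝ} (h1 : ε < εs₁) (h12 : εs₁ ≤ εs₂) :
    tsp ^ 2 / (εs₂ - ε) ≤ tsp ^ 2 / (εs₁ - ε) :=
  div_le_div_of_nonneg_left (sq_nonneg _) (by linarith) (by linarith)

/-- `t_B` does not see the size of the admixture: any two co-shifts give the same `t_B`. [folklore] -/
theorem tB4_coshift_coshift (Δ tpd tpp c a₁ a₂ : ℝ) :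
    tB4 Δ tpd (tpp + a₁) (c + a₁) = tB4 Δ tpd (tpp + a₂) (c + a₂) := by
  rw [tB4_coshift, tB4_coshift]

/-- `t′_B` is ANTITONE in the admixture: `a₂ ≤ a₁ ⇒ t′_B(a₁) ≤ t′_B(a₂)`. [folklore] -/
theorem tpB4_coshift_anti {Δ tpd tpp c a₁ a₂ : ℝ} (h : a₂ ≤ a₁) :
    tpB4 Δ tpd (tpp + a₁) (c + a₁) ≤ tpB4 Δ tpd (tpp + a₂) (c + a₂) := by
  have h' := tpB4_coshift_le (Δ := Δ) (tpd := tpd) (tpp := tpp + a₂) (c := c + a₂)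
    (a := a₁ - a₂) (by linarith)
  have e1 : tpp + a₂ + (a₁ - a₂) = tpp + a₁ := by ring
  have e2 : c + a₂ + (a₁ - a₂) = c + a₁ := by ring
  rw [e1, e2] at h'
  exact h'

/-- `t″_B` is MONOTONE in the admixture: `a₂ ≤ a₁ ⇒ t″_B(a₂) ≤ t″_B(a₁)`. [folklore] -/
theorem tppB4_coshift_mono {Δ tpd tpp c a₁ a₂ : ℝ} (h : a₂ ≤ a₁) :
    tppB4 Δ tpd (tpp + a₂) (c + a₂) ≤ tppB4 Δ tpd (tpp + a₁) (c + a₁) := by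
  have h' := le_tppB4_coshift (Δ := Δ) (tpd := tpd) (tpp := tpp + a₂) (c := c + a₂)
    (a := a₁ - a₂) (by linarith)
  have e1 : tpp + a₂ + (a₁ - a₂) = tpp + a₁ := by ring
  have e2 : c + a₂ + (a₁ - a₂) = c + a₁ := by ring
  rw [e1, e2] at h'
  exact h'

/-- The nesting-line combination `t′_B − 2t″_B` (object E) is ANTITONE in the admixture. [folklore] -/
theorem tpEff_coshift_anti {Δ tpd tpp c a₁ a₂ : ℝ} (h : a₂ ≤ a₁) :
    tpB4 Δ tpd (tpp + a₁) (c + a₁) - 2 * tppB4 Δ tpd (tpp + a₁) (c + a₁) ≤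
      tpB4 Δ tpd (tpp + a₂) (c + a₂) - 2 * tppB4 Δ tpd (tpp + a₂) (c + a₂) := by
  have h1 := tpB4_coshift_anti (Δ := Δ) (tpd := tpd) (tpp := tpp) (c := c) h
  have h2 := tppB4_coshift_mono (Δ := Δ) (tpd := tpd) (tpp := tpp) (c := c) h
  linarith

open Literature.MathematicalPhysics.QuantumLattice.CuprateFourOrbital in
/-- lit-1's axial level is MONOTONE (weakly) in the squared Cu-s/apical coupling when the apical
hybrid lies below `ε_F` (the `≤` companion of `axialLevel_lt_of_sq_lt`).
[cite: PavariniEtAl2001, p. 4] -/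
theorem axialLevel_mono_sq {εsbar εF εc tsc₁ tsc₂ : ℝ} (hc : εc < εF) (h : tsc₁ ^ 2 ≤ tsc₂ ^ 2) :
    axialLevel εsbar εF εc tsc₁ ≤ axialLevel εsbar εF εc tsc₂ := by
  unfold axialLevel
  have hpos : 0 < εF - εc := by linarith
  have : 2 * tsc₁ ^ 2 / (εF - εc) ≤ 2 * tsc₂ ^ 2 / (εF - εc) :=
    div_le_div_of_nonneg_right (by linarith) hpos.le
  linarith

open Literature.MathematicalPhysics.QuantumLattice.CuprateFourOrbital in
/-- **The apical lever on technique B, `t`.** A stronger Cu-s/apical coupling changes nothing in `t_B`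
(composition of `tB4_coshift` with lit-1's `axialLevel`). [folklore] -/
theorem tB4_apical_lever (Δ tpd tpp c tsp ε εsbar εF εc tsc₁ tsc₂ : ℝ) :
    tB4 Δ tpd (tpp + tsp ^ 2 / (axialLevel εsbar εF εc tsc₂ - ε))
        (c + tsp ^ 2 / (axialLevel εsbar εF εc tsc₂ - ε)) =
      tB4 Δ tpd (tpp + tsp ^ 2 / (axialLevel εsbar εF εc tsc₁ - ε))
        (c + tsp ^ 2 / (axialLevel εsbar εF εc tsc₁ - ε)) :=
  tB4_coshift_coshift Δ tpd tpp c _ _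

open Literature.MathematicalPhysics.QuantumLattice.CuprateFourOrbital in
/-- **The apical lever on technique B, `t′`.** With the apical hybrid below `ε_F` (`ε_c < ε_F`) and the
band energy below the axial level of the WEAKER coupling (`ε < ε_s(t_sc₁)`), a STRONGER Cu-s/apical
coupling (`t_sc₁² ≤ t_sc₂²`: shorter Cu–O_apical distance, compression) gives the LESS cuprate-like
`t′_B`: `t′_B(a(t_sc₁)) ≤ t′_B(a(t_sc₂))` — the four-point face of "`r` increases with `d_{Cu–O_c}`"
(`rangeParam_apical_lever`) read in the pressure direction. [cite: PavariniEtAl2001, p. 4 and Fig. 3] -/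
theorem tpB4_apical_lever (Δ tpd tpp c tsp ε εsbar εF εc tsc₁ tsc₂ : ℝ) (hc : εc < εF)
    (h : tsc₁ ^ 2 ≤ tsc₂ ^ 2) (hε : ε < axialLevel εsbar εF εc tsc₁) :
    tpB4 Δ tpd (tpp + tsp ^ 2 / (axialLevel εsbar εF εc tsc₁ - ε))
        (c + tsp ^ 2 / (axialLevel εsbar εF εc tsc₁ - ε)) ≤
      tpB4 Δ tpd (tpp + tsp ^ 2 / (axialLevel εsbar εF εc tsc₂ - ε))
        (c + tsp ^ 2 / (axialLevel εsbar εF εc tsc₂ - ε)) :=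
  tpB4_coshift_anti (axialShift_anti hε (axialLevel_mono_sq hc h))

open Literature.MathematicalPhysics.QuantumLattice.CuprateFourOrbital in
/-- **The apical lever on technique B, `t″`.** Under the same hypotheses the stronger coupling gives
the SMALLER `t″_B` (by half the `t′_B` change, `tppB4_coshift_eq_neg_half`). [folklore] -/
theorem tppB4_apical_lever (Δ tpd tpp c tsp ε εsbar εF εc tsc₁ tsc₂ : ℝ) (hc : εc < εF)
    (h : tsc₁ ^ 2 ≤ tsc₂ ^ 2) (hε : ε < axialLevel εsbar εF εc tsc₁) :
    tppB4 Δ tpd (tpp + tsp ^ 2 / (axialLevel εsbar εF εc tsc₂ - ε))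
        (c + tsp ^ 2 / (axialLevel εsbar εF εc tsc₂ - ε)) ≤
      tppB4 Δ tpd (tpp + tsp ^ 2 / (axialLevel εsbar εF εc tsc₁ - ε))
        (c + tsp ^ 2 / (axialLevel εsbar εF εc tsc₁ - ε)) :=
  tppB4_coshift_mono (axialShift_anti hε (axialLevel_mono_sq hc h))

open Literature.MathematicalPhysics.QuantumLattice.CuprateFourOrbital in
/-- **The apical lever on object E.** Under the same hypotheses the nesting-line `t′_B − 2t″_B`
(object E's `t′_eff`) is LESS cuprate-like at the stronger coupling, by twice the `t′_B` change
(`tpEff_coshift_sub`). [folklore] -/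
theorem tpEff_apical_lever (Δ tpd tpp c tsp ε εsbar εF εc tsc₁ tsc₂ : ℝ) (hc : εc < εF)
    (h : tsc₁ ^ 2 ≤ tsc₂ ^ 2) (hε : ε < axialLevel εsbar εF εc tsc₁) :
    tpB4 Δ tpd (tpp + tsp ^ 2 / (axialLevel εsbar εF εc tsc₁ - ε))
        (c + tsp ^ 2 / (axialLevel εsbar εF εc tsc₁ - ε)) -
      2 * tppB4 Δ tpd (tpp + tsp ^ 2 / (axialLevel εsbar εF εc tsc₁ - ε))
        (c + tsp ^ 2 / (axialLevel εsbar εF εc tsc₁ - ε)) ≤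
    tpB4 Δ tpd (tpp + tsp ^ 2 / (axialLevel εsbar εF εc tsc₂ - ε))
        (c + tsp ^ 2 / (axialLevel εsbar εF εc tsc₂ - ε)) -
      2 * tppB4 Δ tpd (tpp + tsp ^ 2 / (axialLevel εsbar εF εc tsc₂ - ε))
        (c + tsp ^ 2 / (axialLevel εsbar εF εc tsc₂ - ε)) :=
  tpEff_coshift_anti (axialShift_anti hε (axialLevel_mono_sq hc h))
end Summit.Ventures.CertifiedManyBodySolver.Downfold.Emery

end
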